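import Summits.BirchSwinnertonDyer.BirchSwinnertonDyer.Theorems.CMKolyvaginAtInertTwoPairCurrencyAtTwo
import HarnessLib

/-!
# Route `CMKolyvaginAtInertTwo`, crux `CMKolyvaginExactAtInertTwo` (stmt-BirchSwinnertonDyer-24277):
# THE PAIRING `Q₁ ⊕ Q₂` TRANSPORTED TO A SELMER GROUP OF THE PAIR (the `P` of the telescope)

Seat `bsd-line-cmk2-p1` g14 (cell `bsd-print-cf2`); helper (`--supports stmt-BirchSwinnertonDyer-24277`).
ONE DEFINITION (`transportPairing`, pure algebra) and its API; no named fact, no `sorry`; no item is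
closed; BSD is not proved by this.

In the T2 design (KERNEL-STATUS §13.2) the telescope's bi-additive `P : Sd.Sel →+ Sd.Sel →+ R` on the
`ℚ`-Selmer sub-carrier `Sd.Sel ≤ V^{ε} × V^{−ε}` is `CT_{E^{ε}} ⊕ CT_{E^{−ε}}` transported along the
(injective) descent maps `J₁ : T₁ → V^{ε}`, `J₂ : T₂ → V^{−ε}` (`T₁ = Sel_{2^M}(E^{ε}/ℚ)`,
`T₂ = Sel_{2^M}(E^{−ε}/ℚ)`): for a subgroup `Sel` of a product `X × Y` contained in
`range J₁ × range J₂` and pairings `Q₁` on `T₁`, `Q₂` on `T₂`,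
`transportPairing … ⟨(J₁ t₁, J₂ t₂), _⟩ ⟨(J₁ t₁', J₂ t₂'), _⟩ = Q₁ t₁ t₁' + Q₂ t₂ t₂'`
(`transportPairing_apply`), so it has NO CROSS TERMS and vanishes wherever `Q₁` and `Q₂` do
(`transportPairing_eq_zero`) — the compatibility input `hP` of `card_mul_card_le_two_pow_two_mul`
(p689732) for `Q₁ = B_A ∘ (π × π)`, `Q₂ = B_B`.

* `selFst`, `selSnd` — the component maps `Sel → T₁`, `Sel → T₂` (inverse of `J_i` on its range);
* `transportPairing` — the definition; `transportPairing_apply`, `transportPairing_eq_zero`.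

References: [McCallumLMS1991] §5 Thm. 5.4 (the pairing on `S_{p^M}`); [Kolyvagin1989Izv] §3 (the pair
`(E, E^D)` over `ℚ`).
-/

-- single-conjunct summit: `Summit.BirchSwinnertonDyer.BirchSwinnertonDyer.…` repeats the name by design
set_option linter.dupNamespace false
set_option autoImplicit false

noncomputable section

open scoped Classical

namespace Summit.BirchSwinnertonDyer.BirchSwinnertonDyer.Theorems.KolyvaginPairDataTwo

variable {X Y : Type*} [AddCommGroup X] [AddCommGroup Y] {T₁ T₂ R : Type*} [AddCommGroup T₁]
  [AddCommGroup T₂] [AddCommGroup R]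
  {J₁ : T₁ →+ X} {J₂ : T₂ →+ Y} (hJ₁ : Function.Injective J₁) (hJ₂ : Function.Injective J₂)
  {Sel : AddSubgroup (X × Y)} (hSel : ∀ s ∈ Sel, s.1 ∈ J₁.range ∧ s.2 ∈ J₂.range)

/-- The first component `Sel → T₁`: `(J₁ t₁, y) ↦ t₁` (inverse of the injection `J₁` on its range).
[cite: Kolyvagin1989Izv, §3] -/
def selFst : Sel →+ T₁ :=
  (AddMonoidHom.ofInjective hJ₁).symm.toAddMonoidHom.comp
    (((AddMonoidHom.fst X Y).comp Sel.subtype).codRestrict J₁.range fun s ↦ (hSel s s.2).1)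

omit hJ₁ in
/-- The second component `Sel → T₂`: `(x, J₂ t₂) ↦ t₂`. [cite: Kolyvagin1989Izv, §3] -/
def selSnd : Sel →+ T₂ :=
  (AddMonoidHom.ofInjective hJ₂).symm.toAddMonoidHom.comp
    (((AddMonoidHom.snd X Y).comp Sel.subtype).codRestrict J₂.range fun s ↦ (hSel s s.2).2)

/-- `selFst (J₁ t₁, y) = t₁`. [folklore] -/
theorem selFst_apply {t₁ : T₁} {y : Y} (h : ((J₁ t₁, y) : X × Y) ∈ Sel) :
    selFst hJ₁ hSel ⟨(J₁ t₁, y), h⟩ = t₁ := by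
  apply hJ₁
  rw [selFst, AddMonoidHom.comp_apply, AddEquiv.coe_toAddMonoidHom, AddMonoidHom.apply_ofInjective_symm]
  rfl

omit hJ₁ in
/-- `selSnd (x, J₂ t₂) = t₂`. [folklore] -/
theorem selSnd_apply {x : X} {t₂ : T₂} (h : ((x, J₂ t₂) : X × Y) ∈ Sel) :
    selSnd hJ₂ hSel ⟨(x, J₂ t₂), h⟩ = t₂ := by
  apply hJ₂
  rw [selSnd, AddMonoidHom.comp_apply, AddEquiv.coe_toAddMonoidHom, AddMonoidHom.apply_ofInjective_symm]
  rfl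

/-- **The pairing `Q₁ ⊕ Q₂` transported to `Sel`**: `(s, s') ↦ Q₁ (s₁) (s'₁) + Q₂ (s₂) (s'₂)` in the
coordinates `T₁`, `T₂`. [cite: McCallumLMS1991, §5 Thm. 5.4 (the pairing ⟨ , ⟩ on S_{p^M})]
[cite: Kolyvagin1989Izv, §3] -/
def transportPairing (Q₁ : T₁ →+ T₁ →+ R) (Q₂ : T₂ →+ T₂ →+ R) : Sel →+ Sel →+ R :=
  (Q₁.comp (selFst hJ₁ hSel)).compl₂ (selFst hJ₁ hSel) + (Q₂.comp (selSnd hJ₂ hSel)).compl₂ (selSnd hJ₂ hSel)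

/-- **No cross terms**: `P (J₁ t₁, J₂ t₂) (J₁ t₁', J₂ t₂') = Q₁ t₁ t₁' + Q₂ t₂ t₂'`. [folklore] -/
theorem transportPairing_apply (Q₁ : T₁ →+ T₁ →+ R) (Q₂ : T₂ →+ T₂ →+ R) {t₁ t₁' : T₁} {t₂ t₂' : T₂}
    (h : ((J₁ t₁, J₂ t₂) : X × Y) ∈ Sel) (h' : ((J₁ t₁', J₂ t₂') : X × Y) ∈ Sel) :
    transportPairing hJ₁ hJ₂ hSel Q₁ Q₂ ⟨(J₁ t₁, J₂ t₂), h⟩ ⟨(J₁ t₁', J₂ t₂'), h'⟩ =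
      Q₁ t₁ t₁' + Q₂ t₂ t₂' := by
  rw [transportPairing, AddMonoidHom.add_apply, AddMonoidHom.add_apply, AddMonoidHom.compl₂_apply,
    AddMonoidHom.compl₂_apply, AddMonoidHom.comp_apply, AddMonoidHom.comp_apply,
    selFst_apply hJ₁ hSel h, selFst_apply hJ₁ hSel h', selSnd_apply hJ₂ hSel h, selSnd_apply hJ₂ hSel h']

/-- **The transported pairing vanishes wherever `Q₁` and `Q₂` do** (the compatibility `hP` of
`card_mul_card_le_two_pow_two_mul`). [folklore] -/
theorem transportPairing_eq_zero (Q₁ : T₁ →+ T₁ →+ R) (Q₂ : T₂ →+ T₂ →+ R) {t₁ t₁' : T₁} {t₂ t₂' : T₂}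
    (h : ((J₁ t₁, J₂ t₂) : X × Y) ∈ Sel) (h' : ((J₁ t₁', J₂ t₂') : X × Y) ∈ Sel)
    (h₁ : Q₁ t₁ t₁' = 0) (h₂ : Q₂ t₂ t₂' = 0) :
    transportPairing hJ₁ hJ₂ hSel Q₁ Q₂ ⟨(J₁ t₁, J₂ t₂), h⟩ ⟨(J₁ t₁', J₂ t₂'), h'⟩ = 0 := by
  rw [transportPairing_apply, h₁, h₂, add_zero]

include hSel in
/-- Every element of `Sel` has the form `(J₁ t₁, J₂ t₂)`. [folklore] -/
theorem exists_eq_pair (s : X × Y) (hs : s ∈ Sel) : ∃ t₁ t₂, s = (J₁ t₁, J₂ t₂) := by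
  obtain ⟨⟨t₁, h₁⟩, ⟨t₂, h₂⟩⟩ := hSel s hs
  exact ⟨t₁, t₂, Prod.ext h₁.symm h₂.symm⟩

/-- **The general value**: `P s s' = Q₁ (selFst s) (selFst s') + Q₂ (selSnd s) (selSnd s')`. [folklore] -/
theorem transportPairing_apply' (Q₁ : T₁ →+ T₁ →+ R) (Q₂ : T₂ →+ T₂ →+ R) (s s' : Sel) :
    transportPairing hJ₁ hJ₂ hSel Q₁ Q₂ s s' =
      Q₁ (selFst hJ₁ hSel s) (selFst hJ₁ hSel s') + Q₂ (selSnd hJ₂ hSel s) (selSnd hJ₂ hSel s') := by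
  rw [transportPairing, AddMonoidHom.add_apply, AddMonoidHom.add_apply, AddMonoidHom.compl₂_apply,
    AddMonoidHom.compl₂_apply, AddMonoidHom.comp_apply, AddMonoidHom.comp_apply]

/-- `J₁ (selFst s) = s.1`. [folklore] -/
theorem apply_selFst (s : Sel) : J₁ (selFst hJ₁ hSel s) = (s : X × Y).1 := by
  rw [selFst, AddMonoidHom.comp_apply, AddEquiv.coe_toAddMonoidHom, AddMonoidHom.apply_ofInjective_symm]
  rfl

omit hJ₁ in
/-- `J₂ (selSnd s) = s.2`. [folklore] -/
theorem apply_selSnd (s : Sel) : J₂ (selSnd hJ₂ hSel s) = (s : X × Y).2 := by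
  rw [selSnd, AddMonoidHom.comp_apply, AddEquiv.coe_toAddMonoidHom, AddMonoidHom.apply_ofInjective_symm]
  rfl

end Summit.BirchSwinnertonDyer.BirchSwinnertonDyer.Theorems.KolyvaginPairDataTwo

end
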